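import Summits.BirchSwinnertonDyer.BirchSwinnertonDyer.Theorems.ClassRecordThreeEulerHalvesAtThreeCartanCuspNoFixedVector
import HarnessLib

/-!
# Crux 23422 `EulerHalvesAtThreeResidualUpperBound`, line `cartan`: the mod-`3` clause `(𝓛/3𝓛)^G = 0` from a SATURATION hypothesis (the
# principal-series counterpart of `…CartanCuspNoFixedVector`)

Seat `bsd-stepL-tam3-p1` g24 (prover, LINE OWNER of 23422; `--supports stmt-BirchSwinnertonDyer-23422 --as helper`). Companion of p710975. At principal-series Cartan
primes `q ≡ 1 (3)` the reduction of `W_q = Ind_B^G θ̃` mod `3` has the trivial Brauer constituent, so `noFixedVectorModThree` is NOT automatic; the paper analysis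
(`HOME/tam3-p1/g24/NUM-PROOF-SKETCH.md` §4) reduces it to the SATURATION (♠) «`𝕃^H + 𝕃^{wHw⁻¹}` is `3`-saturated in `𝕃`» for a subgroup `H` of order prime to `3`
(there: the prime-to-`3` Borel), which in the hom-lattice dictionary is an Ihara-type lemma for the two maps `X̄/T' ⇉ X̄/H` and holds because `ρ̄_{E,3}` is ramified
at `q` (numerically: `IHARA-j329282.tsv`, index 1 in 49∕49 cases). THIS FILE proves the ABSTRACT ALGEBRAIC STEP, for any finite group: if `H ≤ S`, `wHw⁻¹ ≤ S`,
`Σ_{s ∈ S} tr ρ(s) = 0` (so `𝓛^S = 0`), `gcd(|H|, ℓ) = 1`, and `𝓛^H + 𝓛^{wHw⁻¹}` is `ℓ`-saturated, then `𝓛` has no non-zero vector fixed mod `ℓ` by `H`, `wHw⁻¹`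
(a fortiori none fixed by `G`): average `v` over `H` and over `wHw⁻¹` (`u₀ ≡ |H|v ≡ u₁ (mod ℓ)`), write `u₀ − u₁ = ℓ z`, saturate `z = a + a'`, and observe
`u₀ − ℓa = u₁ + ℓa' ∈ 𝓛^H ∩ 𝓛^{wHw⁻¹} ⊆ 𝓛^S = 0`, so `|H|·v ∈ ℓ𝓛`. HONEST: finite-group∕lattice algebra only; the saturation (♠) for `Hom(J_X̄, E)` is NOT proved
here (it is the geometric input); NUM ∕ (F2b♭) ∕ the crux are NOT proved; BSD is proved for no curve. [folklore]
-/

set_option linter.dupNamespace false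
set_option autoImplicit false

namespace Summit.BirchSwinnertonDyer.BirchSwinnertonDyer.Theorems.CartanSupply.CuspNoFixed

open scoped Classical

section saturated

variable {G : Type*} [Group G] {d : ℕ} (ρ : Representation ℤ G (Fin d → ℤ))

/-- PROVED: the fixed sublattice of the conjugate subgroup `w H w⁻¹` is `ρ(w)` applied to the fixed sublattice of `H` — here only the
elementary half we need: if `v` is fixed by every `w h w⁻¹` then `ρ(w⁻¹) v` is fixed by `H`. [folklore] -/
theorem inv_smul_mem_fixedSub_of_conj (H : Subgroup G) [Fintype H] (w : G) (v : Fin d → ℤ)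
    (hv : ∀ h : H, ρ (w * (h : G) * w⁻¹) v = v) : ρ w⁻¹ v ∈ fixedSub ρ H := by
  intro h
  have h1 := hv h
  have key : ρ (h : G) (ρ w⁻¹ v) = ρ w⁻¹ (ρ (w * (h : G) * w⁻¹) v) := by
    rw [← Module.End.mul_apply, ← map_mul, ← Module.End.mul_apply, ← map_mul]
    congr 1
    group
  rw [key, h1]

/-- PROVED — **THE ABSTRACT SATURATION LEMMA**: let `H ≤ G`, `w ∈ G` with `𝓛^H ∩ 𝓛^{wHw⁻¹} = 0` (e.g. `⟨H, wHw⁻¹⟩` has no fixed line) and `gcd(|H|, ℓ) = 1`; assume the sum of the two fixed sublattices `𝓛^H + ρ(w)𝓛^H` (`= 𝓛^H + 𝓛^{wHw⁻¹}`) is `ℓ`-SATURATED in `𝓛 = ℤ^d`.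
Then a vector fixed modulo `ℓ` by `H` and by `w H w⁻¹` lies in `ℓ𝓛`. [folklore] -/
theorem exists_eq_smul_of_fixedMod_of_saturated (H : Subgroup G) [Fintype H] (w : G)
    (hzero : ∀ x : Fin d → ℤ, (∀ h : H, ρ (h : G) x = x) → (∀ h : H, ρ (w * (h : G) * w⁻¹) x = x) → x = 0)
    (ℓ : ℤ) (hcop : IsCoprime (Fintype.card H : ℤ) ℓ)
    (hsat : ∀ z : Fin d → ℤ, (∃ a ∈ fixedSub ρ H, ∃ a' ∈ fixedSub ρ H, ℓ • z = a + ρ w a') →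
      ∃ a ∈ fixedSub ρ H, ∃ a' ∈ fixedSub ρ H, z = a + ρ w a')
    (v : Fin d → ℤ) (hvH : ∀ h : H, ∃ y : Fin d → ℤ, ρ (h : G) v - v = ℓ • y)
    (hvHw : ∀ h : H, ∃ y : Fin d → ℤ, ρ (w * (h : G) * w⁻¹) v - v = ℓ • y) :
    ∃ y : Fin d → ℤ, v = ℓ • y := by
  choose y0 hy0 using hvH
  choose y1 hy1 using hvHw
  set u0 : Fin d → ℤ := ∑ h : H, ρ (h : G) v with hu0
  set u1 : Fin d → ℤ := ∑ h : H, ρ (w * (h : G) * w⁻¹) v with hu1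
  have hu0mem : u0 ∈ fixedSub ρ H := sum_mem_fixedSub ρ H v
  have hu1fix : ∀ h : H, ρ (w * (h : G) * w⁻¹) u1 = u1 := by
    intro t
    rw [hu1, map_sum]
    have hmul : ∀ h : H, ρ (w * (t : G) * w⁻¹) (ρ (w * (h : G) * w⁻¹) v) = ρ (w * ((t * h : H) : G) * w⁻¹) v := by
      intro h
      rw [← Module.End.mul_apply, ← map_mul]
      congr 2
      rw [Subgroup.coe_mul]
      group
    simp only [hmul]
    exact Fintype.sum_equiv (Equiv.mulLeft t) _ _ (fun s => rfl)
  have hu1mem : ρ w⁻¹ u1 ∈ fixedSub ρ H := inv_smul_mem_fixedSub_of_conj ρ H w u1 hu1fix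
  have hrw0 : ∀ h : H, ρ (h : G) v = v + ℓ • y0 h := fun h => by rw [← hy0 h]; abel
  have hrw1 : ∀ h : H, ρ (w * (h : G) * w⁻¹) v = v + ℓ • y1 h := fun h => by rw [← hy1 h]; abel
  have e0 : u0 = (Fintype.card H : ℤ) • v + ℓ • ∑ h : H, y0 h := by
    rw [hu0]; simp only [hrw0, Finset.sum_add_distrib, Finset.sum_const, Finset.card_univ, ← Finset.smul_sum, natCast_zsmul]
  have e1 : u1 = (Fintype.card H : ℤ) • v + ℓ • ∑ h : H, y1 h := by
    rw [hu1]; simp only [hrw1, Finset.sum_add_distrib, Finset.sum_const, Finset.card_univ, ← Finset.smul_sum, natCast_zsmul]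
  have hww : ρ w (ρ w⁻¹ u1) = u1 := by
    rw [← Module.End.mul_apply, ← map_mul, mul_inv_cancel, map_one, Module.End.one_apply]
  -- u₀ − u₁ = ℓ z, and u₀ − u₁ ∈ 𝓛^H + ρ(w) 𝓛^H
  set z : Fin d → ℤ := (∑ h : H, y0 h) - ∑ h : H, y1 h with hz
  have hdiff : ℓ • z = u0 + ρ w (-(ρ w⁻¹ u1)) := by
    rw [map_neg, hww, hz, e0, e1, smul_sub]
    abel
  obtain ⟨a, ha, a', ha', hzaa⟩ := hsat z ⟨u0, hu0mem, -(ρ w⁻¹ u1), (fixedSub ρ H).neg_mem hu1mem, hdiff⟩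
  -- x := u₀ − ℓ a = ρ w (ρ w⁻¹ u₁ + ℓ a') is fixed by H and by w H w⁻¹, hence by S, hence 0
  have hx1 : u0 - ℓ • a = ρ w (ρ w⁻¹ u1 + ℓ • a') := by
    have h := hdiff
    rw [hzaa, smul_add, map_neg, hww] at h
    rw [map_add, map_smul, hww]
    -- h : ℓ • a + ℓ • ρ w a' = u0 + -u1
    have h' : u0 = ℓ • a + ℓ • ρ w a' + u1 := by rw [h]; abel
    rw [h']; abel
  have hxH : ∀ h : H, ρ (h : G) (u0 - ℓ • a) = u0 - ℓ • a :=
    (fixedSub ρ H).sub_mem hu0mem ((fixedSub ρ H).smul_mem ℓ ha)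
  have hinner : ρ w⁻¹ u1 + ℓ • a' ∈ fixedSub ρ H := (fixedSub ρ H).add_mem hu1mem ((fixedSub ρ H).smul_mem ℓ ha')
  have hxHw : ∀ h : H, ρ (w * (h : G) * w⁻¹) (u0 - ℓ • a) = u0 - ℓ • a := by
    intro h
    rw [hx1, ← Module.End.mul_apply, ← map_mul, show w * (h : G) * w⁻¹ * w = w * (h : G) by group, map_mul, Module.End.mul_apply,
      hinner h]
  have hx0 : u0 - ℓ • a = 0 := hzero _ hxH hxHw
  -- so |H| v = ℓ (a − Σ y₀), and Bézout
  have hHv : (Fintype.card H : ℤ) • v = ℓ • (a - ∑ h : H, y0 h) := by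
    rw [smul_sub]
    have : u0 = ℓ • a := sub_eq_zero.1 hx0
    rw [← this, e0]
    abel
  obtain ⟨c₁, c₂, hc⟩ := hcop
  refine ⟨c₁ • (a - ∑ h : H, y0 h) + c₂ • v, ?_⟩
  calc v = (1 : ℤ) • v := (one_smul ℤ v).symm
    _ = (c₁ * (Fintype.card H : ℤ) + c₂ * ℓ) • v := by rw [hc]
    _ = c₁ • ((Fintype.card H : ℤ) • v) + (c₂ * ℓ) • v := by rw [add_smul, mul_smul]
    _ = c₁ • (ℓ • (a - ∑ h : H, y0 h)) + (c₂ * ℓ) • v := by rw [hHv]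
    _ = ℓ • (c₁ • (a - ∑ h : H, y0 h) + c₂ • v) := by rw [smul_add, smul_comm c₁ ℓ, mul_comm c₂ ℓ, mul_smul]

/-- PROVED — the same with `𝓛^H ∩ 𝓛^{wHw⁻¹} = 0` supplied by RANK-BY-TRACE on a subgroup `S` fixing every such vector (e.g. `S = ⟨H, wHw⁻¹⟩`) whose character
sums to zero, and with the conclusion in the shape of `CartanTorusLattice.noFixedVectorModThree` (hypothesis: fixed mod `ℓ` by ALL of `G`). [folklore] -/
theorem noFixedVectorMod_of_saturated (H S : Subgroup G) [Fintype H] [Fintype S] (w : G)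
    (hgen : ∀ x : Fin d → ℤ, (∀ h : H, ρ (h : G) x = x) → (∀ h : H, ρ (w * (h : G) * w⁻¹) x = x) → ∀ s : S, ρ (s : G) x = x)
    (hsum : ∑ s : S, LinearMap.trace ℤ (Fin d → ℤ) (ρ (s : G)) = 0) (ℓ : ℤ) (hcop : IsCoprime (Fintype.card H : ℤ) ℓ)
    (hsat : ∀ z : Fin d → ℤ, (∃ a ∈ fixedSub ρ H, ∃ a' ∈ fixedSub ρ H, ℓ • z = a + ρ w a') →
      ∃ a ∈ fixedSub ρ H, ∃ a' ∈ fixedSub ρ H, z = a + ρ w a') :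
    ∀ v : Fin d → ℤ, (∀ g : G, ∃ y : Fin d → ℤ, ρ g v - v = ℓ • y) → ∃ y : Fin d → ℤ, v = ℓ • y :=
  fun v hv => exists_eq_smul_of_fixedMod_of_saturated ρ H w
    (fun x hx hx' => eq_zero_of_fixed_of_sum_trace ρ S hsum x (fun s => hgen x hx hx' s)) ℓ hcop hsat v
    (fun h => hv h) (fun h => hv (w * (h : G) * w⁻¹))

end saturated

end Summit.BirchSwinnertonDyer.BirchSwinnertonDyer.Theorems.CartanSupply.CuspNoFixed
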